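/-
Origin: expansion seat `planner-pub-hodgecm-pv14-g5-0`, handover #7 2026-08-18T10:25:40Z (`HOME/pub-hodgecm-pv14-g5/lean/Pv14g5/WeilThetaModelHeisenbergLattice.lean`, md5 3bad0231, 274 lines);
landed by the gen-7 packager in gate run 28 as `HodgeCM/Automorphic/WeilThetaModelHeisenbergLattice.lean` (import ^import Pv14g5\.→import HodgeCM.Automorphic. ×1).
-/
/-
Origin: HOME/pub-hodgecm-pv14-g5/lean/Pv14g5/WeilThetaModelHeisenbergLattice.lean — session planner-pub-hodgecm-pv14-g5-0
(unit pub-hodgecm-pv14-g5, DAG-node prover #14 gen 5).  Intended final place: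
`HodgeCM/Automorphic/WeilThetaModelHeisenbergLattice.lean` (namespace `HodgeCM.SchwartzWeil`).
PACKAGER: rewrite `import Pv14g5.WeilThetaModelHeisenberg` to `import HodgeCM.Automorphic.WeilThetaModelHeisenberg`
(this seat's HANDOVER #5); `HodgeCM.Automorphic.LatticeModelThetaData` is already in the tree (prl1-g4, run 26).
Asserts nothing (no `axiom`, no new constants).
-/
import Summits.HodgeConjecture.HodgeCM.Automorphic.WeilThetaModelHeisenberg_2
import Summits.HodgeConjecture.HodgeCM.Automorphic.LatticeModelThetaData

/-!
# The Heisenberg theta model lives over COCOMPACT LATTICE MODELS: `Heis V ⧸ arith` is a compact nilmanifold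

prl1-g4's junction `LatticeModelThetaData` (run 26) types the Weil theta model of a context as
`WeilThetaModel (latU …).G (latU …).Γ (lat …).G (lat …).Γ` over two `CocompactLatticeModel`s — a locally compact,
Hausdorff, second countable topological group with a DISCRETE subgroup and COMPACT quotient —, from which
`QuotientModel.ofLattice` CONSTRUCTS the measure theory (Haar, unimodularity, fundamental domain).  The models
in the tree so far instantiate this with ABELIAN groups (`Multiplicative E`, tori).  This file proves, in the
kernel, that the genuinely NON-ABELIAN Heisenberg model of `WeilThetaModelHeisenberg` (#5) qualifies:

* `Heis.homeomorphProd : Heis V ≃ₜ V × V × Circle`; instances `T2Space`, `LocallyCompactSpace`,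
  `SecondCountableTopology (Heis V)`.
* **`instDiscreteTopologyArith : DiscreteTopology (arith V L m)`** and
  **`instCompactSpaceQuotientArith : CompactSpace (Heis V ⧸ arith V L m)`** for a full lattice `L` and `m ≠ 0`
  (`[NeZero m]`): the arithmetic subgroup `{(a, b, u) : a ∈ L, m b ∈ L*, uᵐ = 1}` is a discrete COCOMPACT subgroup —
  `Heis V ⧸ arith` is a compact Heisenberg nilmanifold (reduction to the product of closed fundamental
  parallelepipeds of `L` and `m⁻¹ L*` with the circle, via `ZSpan.fract`).
* `heisenbergLatticeModel V L m : CocompactLatticeModel` (`G := Heis V`, `Γ := arith V L m`) and, on the acting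
  side, `circleLatticeModel Γ : CocompactLatticeModel` for a finite `Γ ≤ Circle`
  (`Subgroup.finite_of_forall_zpow_eq_one`); hence `(heisenbergLatticeModel V L m).toQuotientModel` — Haar measure,
  right invariance, fundamental domain of the Heisenberg nilmanifold — comes for free from prl1-g4/pv09-g4.
* **`heisenbergModelOverLattice`**: #5's `heisenbergModel` RE-TYPED as
  `WeilThetaModel (heisenbergLatticeModel V L m).toQuotientModel.G … (circleLatticeModel Γ).toQuotientModel.Γ` —
  literally the type of the field `LatticeModelThetaData.wm` at a pair of lattice models (definitionally the same
  object); and the HYPOTHESIS-FREE instance `heisenbergLatticeModelStd n m` / `heisenbergModelStd n m`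
  (`V = ℝⁿ`, `L = ℤⁿ`, `Γ = ⊥`; every instance found by Lean), `heisenbergModelStd_θ_ne_zero`.

LABELS.  KERNEL (Mathlib + #5).  NOT CLAIMED: that `(Heis V, arith)` IS `(G_U(𝔸), G_U(L⁺))` of PerL (it is not: it
is the real Heisenberg group of one polarised line with its arithmetic subgroup — a MODEL of the junction's data,
showing the data type is inhabited by a non-abelian theta-carrying example with all [SETUP] side conditions PROVED).
-/

set_option autoImplicit false

noncomputable section

open Topology
open scoped RealInnerProductSpace

namespace HodgeCM
namespace SchwartzWeil

/-! ## 1. `Heis V` is (topologically) `V × V × Circle` -/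

namespace Heis

variable {V : Type*} [NormedAddCommGroup V] [InnerProductSpace ℝ V]

/-- `Heis V ≃ₜ V × V × Circle`. -/
def homeomorphProd : Heis V ≃ₜ V × V × Circle where
  toFun := toProd
  invFun p := ⟨p.1, p.2.1, p.2.2⟩
  left_inv _ := rfl
  right_inv _ := rfl
  continuous_toFun := continuous_toProd
  continuous_invFun :=
    continuous_mk continuous_fst (continuous_fst.comp continuous_snd) (continuous_snd.comp continuous_snd)

/-- (Ported verbatim from the HodgeCMPerL package; no docstring in the source.) -/
@[simp] theorem homeomorphProd_apply (h : Heis V) : homeomorphProd h = (h.a, h.b, h.u) := rfl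

/-- (Ported verbatim from the HodgeCMPerL package; no docstring in the source.) -/
theorem isClosedEmbedding_toProd : IsClosedEmbedding (toProd : Heis V → V × V × Circle) :=
  (homeomorphProd (V := V)).isClosedEmbedding

/-- (Ported verbatim from the HodgeCMPerL package; no docstring in the source.) -/
instance instT2Space : T2Space (Heis V) := (isClosedEmbedding_toProd (V := V)).isEmbedding.t2Space

/-- (Ported verbatim from the HodgeCMPerL package; no docstring in the source.) -/
instance instLocallyCompactSpace [LocallyCompactSpace V] : LocallyCompactSpace (Heis V) :=
  (isClosedEmbedding_toProd (V := V)).locallyCompactSpace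

/-- (Ported verbatim from the HodgeCMPerL package; no docstring in the source.) -/
instance instSecondCountableTopology [SecondCountableTopology V] : SecondCountableTopology (Heis V) :=
  (isClosedEmbedding_toProd (V := V)).isInducing.secondCountableTopology

end Heis

/-! ## 2. Two lemmas: closed fundamental parallelepipeds are compact and exhaust `V` mod `L`; `μ_m` is finite -/

section Lemmas

variable {V : Type*} [NormedAddCommGroup V] [InnerProductSpace ℝ V] [FiniteDimensional ℝ V]

/-- A full lattice has a COMPACT set of representatives: `∃ C` compact with `∀ x, ∃ v ∈ L, x - v ∈ C` (the closure of
the fundamental parallelepiped of any `ℤ`-basis, via `ZSpan.fract`). -/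
theorem exists_isCompact_forall_exists_sub_mem (L : Submodule ℤ V) [DiscreteTopology L] [IsZLattice ℝ L] :
    ∃ C : Set V, IsCompact C ∧ ∀ x : V, ∃ v ∈ L, x - v ∈ C := by
  let b := Module.Free.chooseBasis ℤ L
  let B : Module.Basis _ ℝ V := b.ofZLatticeBasis ℝ L
  refine ⟨closure (ZSpan.fundamentalDomain B), (ZSpan.fundamentalDomain_isBounded B).isCompact_closure,
    fun x => ⟨(ZSpan.floor B x : V), ?_, ?_⟩⟩
  · exact (Module.Basis.ofZLatticeBasis_span ℝ L b).le (ZSpan.floor B x).2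
  · rw [← ZSpan.fract_apply]
    exact subset_closure (ZSpan.fract_mem_fundamentalDomain B x)

/-- The `m`-th roots of unity in the circle form a finite set (`m ≠ 0`). -/
theorem Circle.finite_setOf_zpow_eq_one {m : ℤ} (hm : m ≠ 0) : {u : Circle | u ^ m = 1}.Finite := by
  refine ((Polynomial.nthRoots m.natAbs (1 : ℂ)).finite_toSet.preimage
    (Set.injOn_of_injective fun (u v : Circle) (h : (u : ℂ) = v) => Circle.ext h)).subset ?_
  intro u hu
  have hu' : u ^ m.natAbs = 1 := pow_natAbs_eq_one.mpr hu
  show (u : ℂ) ∈ {x : ℂ | x ∈ Polynomial.nthRoots m.natAbs (1 : ℂ)}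
  rw [Set.mem_setOf_eq, Polynomial.mem_nthRoots (Int.natAbs_pos.mpr hm), ← Circle.coe_pow, hu', Circle.coe_one]

/-- A subgroup of the circle of exponent dividing `m ≠ 0` is finite. -/
theorem Subgroup.finite_of_forall_zpow_eq_one {m : ℤ} (hm : m ≠ 0) (Γ : Subgroup Circle)
    (hΓ : ∀ u ∈ Γ, u ^ m = 1) : Finite Γ :=
  haveI := (Circle.finite_setOf_zpow_eq_one hm).to_subtype
  Finite.of_injective (fun γ : Γ => (⟨γ.1, hΓ γ.1 γ.2⟩ : {u : Circle | u ^ m = 1}))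
    fun γ γ' h => Subtype.ext (by simpa using congrArg Subtype.val h)

end Lemmas

/-! ## 3. `arith V L m` is a discrete cocompact subgroup of `Heis V` -/

section Arith

variable (V : Type) [NormedAddCommGroup V] [InnerProductSpace ℝ V] [FiniteDimensional ℝ V]
  (L : Submodule ℤ V) [DiscreteTopology L] [IsZLattice ℝ L] (m : ℤ) [NeZero m]

/-- **The arithmetic subgroup is discrete.** -/
instance instDiscreteTopologyArith : DiscreteTopology (arith V L m) := by
  have hm : m ≠ 0 := NeZero.ne m
  have hm' : (m : ℝ) ≠ 0 := Int.cast_ne_zero.mpr hm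
  haveI := (Circle.finite_setOf_zpow_eq_one hm).to_subtype
  refine DiscreteTopology.of_continuous_injective
    (f := fun γ : arith V L m =>
      ((⟨γ.1.a, γ.2.1⟩ : L), (⟨(m : ℝ) • γ.1.b, γ.2.2.1⟩ : PoissonSummation.dualLattice L),
        (⟨γ.1.u, γ.2.2.2⟩ : {u : Circle | u ^ m = 1}))) ?_ ?_
  · refine ((Heis.continuous_a.comp continuous_subtype_val).subtype_mk _).prodMk
      ((((Heis.continuous_b.comp continuous_subtype_val).const_smul _).subtype_mk _).prodMk
        ((Heis.continuous_u.comp continuous_subtype_val).subtype_mk _))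
  · intro γ γ' h
    simp only [Prod.mk.injEq, Subtype.mk.injEq] at h
    obtain ⟨ha, hb, hu⟩ := h
    exact Subtype.ext (Heis.ext ha (smul_right_injective V hm' hb) hu)

/-- **The quotient `Heis V ⧸ arith V L m` is compact** (a Heisenberg nilmanifold). -/
instance instCompactSpaceQuotientArith : CompactSpace (Heis V ⧸ arith V L m) := by
  have hm : m ≠ 0 := NeZero.ne m
  have hm' : (m : ℝ) ≠ 0 := Int.cast_ne_zero.mpr hm
  obtain ⟨C₁, hC₁, h₁⟩ := exists_isCompact_forall_exists_sub_mem L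
  obtain ⟨C₂, hC₂, h₂⟩ := exists_isCompact_forall_exists_sub_mem (PoissonSummation.dualLattice L)
  haveI := isCompact_iff_compactSpace.mp hC₁
  haveI := isCompact_iff_compactSpace.mp hC₂
  let f : C₁ × C₂ × Circle → Heis V ⧸ arith V L m :=
    fun p => QuotientGroup.mk ⟨(p.1 : V), (m : ℝ)⁻¹ • (p.2.1 : V), p.2.2⟩
  have hf : Continuous f :=
    QuotientGroup.continuous_mk.comp (Heis.continuous_mk (continuous_subtype_val.comp continuous_fst)
      ((continuous_subtype_val.comp (continuous_fst.comp continuous_snd)).const_smul _)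
      (continuous_snd.comp continuous_snd))
  have hsurj : Function.Surjective f := by
    intro q
    induction q using QuotientGroup.induction_on with
    | H h =>
      obtain ⟨v, hv, hvC⟩ := h₁ h.a
      obtain ⟨w, hw, hwC⟩ := h₂ ((m : ℝ) • h.b)
      let γ : Heis V := ⟨-v, -((m : ℝ)⁻¹ • w), 1⟩
      have hγ : γ ∈ arith V L m := by
        refine ⟨L.neg_mem hv, ?_, one_zpow m⟩
        change (m : ℝ) • -((m : ℝ)⁻¹ • w) ∈ PoissonSummation.dualLattice L
        rw [smul_neg, smul_smul, mul_inv_cancel₀ hm', one_smul]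
        exact (PoissonSummation.dualLattice L).neg_mem hw
      refine ⟨(⟨h.a - v, hvC⟩, ⟨(m : ℝ) • h.b - w, hwC⟩, (h * γ).u), ?_⟩
      change (QuotientGroup.mk _ : Heis V ⧸ arith V L m) = QuotientGroup.mk h
      rw [← QuotientGroup.mk_mul_of_mem h hγ]
      congr 1
      ext
      · simp only [Heis.mul_a, γ, sub_eq_add_neg]
      · show (m : ℝ)⁻¹ • ((m : ℝ) • h.b - w) = h.b + -((m : ℝ)⁻¹ • w)
        rw [smul_sub, smul_smul, inv_mul_cancel₀ hm', one_smul, sub_eq_add_neg]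
      · rfl
  exact ⟨by rw [← Set.range_eq_univ.mpr hsurj]; exact isCompact_range hf⟩

end Arith

/-! ## 4. The two cocompact lattice models and the re-typed Weil theta model -/

section Models

variable (V : Type) [NormedAddCommGroup V] [InnerProductSpace ℝ V] [FiniteDimensional ℝ V]
  (L : Submodule ℤ V) [DiscreteTopology L] [IsZLattice ℝ L] (m : ℤ) [NeZero m]

/-- **The Heisenberg nilmanifold as a cocompact lattice model** `(Heis V, arith V L m)`. -/
def heisenbergLatticeModel : CocompactLatticeModel where
  G := Heis V
  Γ := arith V L m

/-- (Ported verbatim from the HodgeCMPerL package; no docstring in the source.) -/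
@[simp] theorem heisenbergLatticeModel_G : (heisenbergLatticeModel V L m).G = Heis V := rfl
/-- (Ported verbatim from the HodgeCMPerL package; no docstring in the source.) -/
@[simp] theorem heisenbergLatticeModel_Γ : (heisenbergLatticeModel V L m).Γ = arith V L m := rfl

omit [FiniteDimensional ℝ V] [DiscreteTopology L] [IsZLattice ℝ L] [NeZero m] in
/-- The acting side: a finite subgroup of the (compact) circle is a cocompact lattice model. -/
def circleLatticeModel (Γ : Subgroup Circle) [Finite Γ] : CocompactLatticeModel where
  G := Circle
  Γ := Γ

/-- (Ported verbatim from the HodgeCMPerL package; no docstring in the source.) -/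
@[simp] theorem circleLatticeModel_G (Γ : Subgroup Circle) [Finite Γ] : (circleLatticeModel Γ).G = Circle := rfl
/-- (Ported verbatim from the HodgeCMPerL package; no docstring in the source.) -/
@[simp] theorem circleLatticeModel_Γ (Γ : Subgroup Circle) [Finite Γ] : (circleLatticeModel Γ).Γ = Γ := rfl

/-- The compact Haar quotient model of the Heisenberg nilmanifold (Haar measure, right invariance by unimodularity,
measurable fundamental domain of finite measure — all CONSTRUCTED by `QuotientModel.ofLattice`). -/
def heisenbergQuotientModel : QuotientModel := (heisenbergLatticeModel V L m).toQuotientModel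

/-- (Ported verbatim from the HodgeCMPerL package; no docstring in the source.) -/
theorem heisenbergQuotientModel_G : (heisenbergQuotientModel V L m).G = Heis V := rfl
/-- (Ported verbatim from the HodgeCMPerL package; no docstring in the source.) -/
theorem heisenbergQuotientModel_Γ : (heisenbergQuotientModel V L m).Γ = arith V L m := rfl

variable [MeasurableSpace V] [BorelSpace V]

/-- **#5's Heisenberg theta model, typed over the two cocompact lattice models** — literally the type of the field
`LatticeModelThetaData.wm` at `(latU, lat) := (heisenbergLatticeModel V L m, circleLatticeModel Γ)`. -/
def heisenbergModelOverLattice (Γ : Subgroup Circle) [Finite Γ] (hΓ : ∀ u ∈ Γ, u ^ m = 1) :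
    WeilThetaModel (heisenbergLatticeModel V L m).toQuotientModel.G (heisenbergLatticeModel V L m).toQuotientModel.Γ
      (circleLatticeModel Γ).toQuotientModel.G (circleLatticeModel Γ).toQuotientModel.Γ :=
  heisenbergModel V L m Γ hΓ

/-- (Ported verbatim from the HodgeCMPerL package; no docstring in the source.) -/
theorem heisenbergModelOverLattice_eq (Γ : Subgroup Circle) [Finite Γ] (hΓ : ∀ u ∈ Γ, u ^ m = 1) :
    heisenbergModelOverLattice V L m Γ hΓ = heisenbergModel V L m Γ hΓ := rfl

/-- Its descended theta kernel is #5's (nonzero, continuous, `arith`-invariant lattice theta series). -/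
theorem heisenbergModelOverLattice_θ (Γ : Subgroup Circle) [Finite Γ] (hΓ : ∀ u ∈ Γ, u ^ m = 1) :
    (heisenbergModelOverLattice V L m Γ hΓ).θ = (heisenbergModel V L m Γ hΓ).θ := rfl

/-- (Ported verbatim from the HodgeCMPerL package; no docstring in the source.) -/
theorem heisenbergModelOverLattice_θ_ne_zero (Γ : Subgroup Circle) [Finite Γ] (hΓ : ∀ u ∈ Γ, u ^ m = 1) :
    ∃ Φ, (heisenbergModelOverLattice V L m Γ hΓ).θ Φ (QuotientGroup.mk 1, QuotientGroup.mk 1) ≠ 0 :=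
  heisenbergModel_θ_ne_zero V L m Γ hΓ

/-- The version taking the exponent hypothesis only (finiteness of `Γ` derived). -/
def heisenbergModelOverLattice' (Γ : Subgroup Circle) (hΓ : ∀ u ∈ Γ, u ^ m = 1) :
    haveI := Subgroup.finite_of_forall_zpow_eq_one (NeZero.ne m) Γ hΓ
    WeilThetaModel (heisenbergLatticeModel V L m).toQuotientModel.G (heisenbergLatticeModel V L m).toQuotientModel.Γ
      (circleLatticeModel Γ).toQuotientModel.G (circleLatticeModel Γ).toQuotientModel.Γ :=
  heisenbergModel V L m Γ hΓ

end Models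

/-! ## 5. A hypothesis-free instance: `V = ℝⁿ`, `L = ℤⁿ`, any `m ≠ 0` -/

section Standard

/-- **The standard Heisenberg nilmanifold model** `(Heis ℝⁿ, arith ℤⁿ m)` — NO hypotheses left (every instance is
found by Lean: `ℤⁿ ⊂ ℝⁿ` is a discrete full lattice, `NeZero m`). -/
def heisenbergLatticeModelStd (n : ℕ) (m : ℤ) [NeZero m] : CocompactLatticeModel :=
  heisenbergLatticeModel (EuclideanSpace ℝ (Fin n))
    (Submodule.span ℤ (Set.range (PiLp.basisFun 2 ℝ (Fin n)))) m

/-- (Ported verbatim from the HodgeCMPerL package; no docstring in the source.) -/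
theorem heisenbergLatticeModelStd_G (n : ℕ) (m : ℤ) [NeZero m] :
    (heisenbergLatticeModelStd n m).G = Heis (EuclideanSpace ℝ (Fin n)) := rfl

/-- … and its Weil theta model over the pair of lattice models, acting group `Circle ⊇ Γ = ⊥`. -/
def heisenbergModelStd (n : ℕ) (m : ℤ) [NeZero m] :
    WeilThetaModel (heisenbergLatticeModelStd n m).toQuotientModel.G (heisenbergLatticeModelStd n m).toQuotientModel.Γ
      (circleLatticeModel (⊥ : Subgroup Circle)).toQuotientModel.G
      (circleLatticeModel (⊥ : Subgroup Circle)).toQuotientModel.Γ :=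
  heisenbergModelOverLattice (EuclideanSpace ℝ (Fin n)) (Submodule.span ℤ (Set.range (PiLp.basisFun 2 ℝ (Fin n)))) m
    ⊥ fun u hu => by rw [Subgroup.mem_bot.mp hu, one_zpow]

/-- (Ported verbatim from the HodgeCMPerL package; no docstring in the source.) -/
theorem heisenbergModelStd_θ_ne_zero (n : ℕ) (m : ℤ) [NeZero m] :
    ∃ Φ, (heisenbergModelStd n m).θ Φ (QuotientGroup.mk 1, QuotientGroup.mk 1) ≠ 0 :=
  heisenbergModelOverLattice_θ_ne_zero _ _ _ _ _

end Standard

end SchwartzWeil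
end HodgeCM

end
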